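import Literature.AnabelianGeometry.SemiGraphs.UniversalCoveringCompactInVerticial
import Literature.AnabelianGeometry.SemiGraphs.CoveringGraphGaloisCountable
import Literature.AnabelianGeometry.SemiGraphs.TemperedReconstructionCor39UpToTwistProofsAt
import HarnessLib

/-!
# [SemiAnbd] Corollary 3.9 (up to twist) AT PAIRS OF UNIVERSAL GRAPH-COVERINGS `𝒢_{∞,F}`, `ℋ_{∞,F′}`
# of FINITE coherent Cor-3.9 graphs — hypothesis-free beyond print's hypotheses on the finite bases

Mochizuki, *Semi-graphs of anabelioids*, Publ. RIMS **42** (2006), §3: p. 38 ("`𝒢_{∞,i} → 𝒢_i` for the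
covering of `𝒢_i` determined by the universal graph-covering of the underlying semi-graph `𝔾_i` … the
`𝒢_{∞,i} → 𝒢` are tempered coverings of `𝒢`"), Cor. 3.9 p. 42 and its proof p. 43 l. 13–15 ("[again by
Theorem 3.7, (iii), (iv)]") [cite: MochizukiSemiAnbd2006, Cor 3.9 pp.42-43].  The consumer in print is
[EtTh] §1–§2, where Thm. 3.7 / Cor. 3.9 are applied to the infinite chains `Ÿ → Y → X` of coverings of a
punctured Tate curve — universal graph-coverings of FINITE dual semi-graphs.

PROOF-ONLY file (cell abc-iut, layer L3, L-F pack A, L3-lead gen 6 ruling β13 (1) row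
«COR39@UNIV-COVERINGS»; seat abc-iut-L3-d1 gen 7; no definition, no new named fact).  The cell's
per-pair closer of record for Cor. 3.9 over the compatible reading of Def. 3.8, "induced" read up to the
2-cells of Rmk. 2.4.2 (`cor39UpToTwistAt`, abc-iut-w4-d080), takes exactly Theorem 3.7 (iii) AT `G` and
AT `H` (`CompactInVerticialAt`).  The ∀-countable typing of Thm. 3.7 (iii) is kernel-refuted at the θ-ray
`𝒢_θ` (abc-iut-L3-d4), so at infinite graphs that input is a genuine hypothesis; at LOCALLY FINITE graphs
it is equivalent to the elementwise sentence (CE) «every compact element is verticial» (abc-iut-w6-d062,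
abc-iut-L3-t10 `TemperedReconstructionCor39LocallyFinite`).  At the infinite graphs print actually uses —
the covering semi-graphs of anabelioids `𝒢_{∞,F}` of the universal graph-coverings `F.univCoverOver`
over FINITE coherent bases — Thm. 3.7 (iii) AT the graph is a THEOREM (abc-iut-w6-d120,
`CovObj.compactInVerticialAt_univCoverOver`; equivalently abc-iut-L3-d6's heredity
`compactInVerticialAt_coveringGraph_of_finite'` at the tempered object `𝒢_{∞,F}`), so (CE) is
discharged there and Cor. 3.9 holds at every such pair with NO residual hypothesis.  Everything below is
BY NAME, no new argument:

* `CovObj.univCoverOver_isTempered_of_cor39`, `CovObj.isConnectedObj_univCoverOverT_of_cor39`,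
  `CovObj.cor39Hypotheses_univCoverOver`, `CovObj.compactInVerticialAt_univCoverOver_of_cor39` — for a
  FINITE covering object `F` of a FINITE coherent Cor-3.9 graph `𝒢` and a vertex-orbit `V₀`: `𝒢_{∞,F}`
  is a connected tempered object, satisfies the hypotheses of Cor. 3.9 (abc-iut-L3-d6's
  `cor39Hypotheses_coveringGraph_of_finite` at abc-iut-L3-d5's `isConnectedObj_univCoverOverT`), and
  satisfies Thm. 3.7 (iii) AT the graph;
* `CovObj.cor39UpToTwistAt_univCoverOver` / `CovObj.cor39UpToTwist_baseAt_univCoverOver` /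
  `CovObj.cor39CompatUpToTwistAt_univCoverOver` — **Corollary 3.9 (a) + (b) with uniqueness, up to
  twist, at EVERY pair `(𝒢_{∞,F}, ℋ_{∞,F′})`**, every pair of charts, in the three currencies of the
  tree (vertex/edge maps; full underlying morphism; the named `InducesUpToTwist`), with the named
  projections (a) `isCompatiblyQuasiGeometric_of_inducesUpToTwist_univCoverOver` and (b)-existence
  `exists_hom_inducesUpToTwist_univCoverOver`;
* the MIXED pairs `(𝒢_{∞,F}, ℋ_T)` for ANY connected tempered covering `T` of a finite coherent Cor-3.9
  `ℋ` (`cor39UpToTwistAt_univCoverOver_coveringGraph`), and `(𝒢_{∞,F}, ℋ)` with a FINITE Cor-3.9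
  partner `ℋ` (`cor39UpToTwistAt_univCoverOver_of_finite`; the shape of the covering map `Y → X` itself);
* the ONE-SHEETED case `F := trivialCov 𝒢 PUnit` (`𝒢_∞` proper, the universal graph-covering of `𝔾`;
  for the Tate dual graph, the chain `Y` of [EtTh] §1): `cor39Hypotheses_univCover`,
  `cor39UpToTwistAt_univCover`, `cor39CompatUpToTwistAt_univCover`.

HONEST FRAMING.  OUR rendering of a refereed paper's Cor. 3.9 at OUR typed objects; the literal
chosen-conjugator `Cor39` and the ∀-countable `Cor39Compat`/`Cor39CompatUpToTwist` stay refuted/open as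
recorded elsewhere (abc-iut-f-175); nothing here asserts Thm. 3.7 (iii) for an arbitrary countable graph;
nothing here bears on [IUTchIII] Cor. 3.12 and nothing asserts abc proved or refuted.  typed ≠ proved.
-/

open CategoryTheory

namespace Literature.AnabelianGeometry.SemiGraphs

namespace ProfiniteSemiGraph

open Literature.AlgebraicGeometry.Frobenioids (IsConnectedObj)

universe u

variable {𝒢 ℋ : ProfiniteSemiGraph.{u}}

namespace CovObj

variable (F : CovObj 𝒢) (F' : CovObj ℋ)

/-! ### `𝒢_{∞,F}` over a finite coherent Cor-3.9 graph: tempered, connected, Cor-3.9, Thm 3.7 (iii) -/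

/-- `𝒢_{∞,F} → 𝒢` is tempered for every FINITE covering object `F` of a graph satisfying the hypotheses
of Cor. 3.9 (Galois-countability, [IUTchI] Rmk. 2.5.3 (i) (T2), is part of the bundle), for any base
vertex-orbit `V₀` and any countability witness. [cite: MochizukiSemiAnbd2006, Prop 3.6 p.38] -/
theorem univCoverOver_isTempered_of_cor39 (h39 : Cor39Hypotheses 𝒢) (hF : F.IsFinite) (V₀ : F.OVertex)
    (h𝒢 : 𝒢.IsCountable) : (F.univCoverOver (Sum.inl V₀) h𝒢).IsTempered :=
  CovObj.univCoverOver_isTempered_of_isGaloisCountable F (Sum.inl V₀) h𝒢 h39.isGaloisCountable hF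

/-- `𝒢_{∞,F}` is a connected object of `B^temp(𝒢)` (abc-iut-L3-d5's `isConnectedObj_univCoverOverT`),
for `F` finite over a Cor-3.9 graph. [cite: MochizukiSemiAnbd2006, Prop 3.6 p.38] -/
theorem isConnectedObj_univCoverOverT_of_cor39 (h39 : Cor39Hypotheses 𝒢) (hF : F.IsFinite)
    (V₀ : F.OVertex) (h𝒢 : 𝒢.IsCountable) :
    IsConnectedObj (⟨F.univCoverOver (Sum.inl V₀) h𝒢,
      F.univCoverOver_isTempered_of_cor39 h39 hF V₀ h𝒢⟩ : BTempCat 𝒢) :=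
  isConnectedObj_univCoverOverT F V₀ h𝒢 _

/-- **The hypotheses of [SemiAnbd] Cor. 3.9 hold at `𝒢_{∞,F}`** — the covering semi-graph of anabelioids
of the universal graph-covering `𝒢_{∞,F} → 𝒢` over a FINITE covering object `F` of a FINITE coherent
graph `𝒢` satisfying the hypotheses of Cor. 3.9 (connected, countable, quasi-coherent, totally elevated,
totally estranged, verticially slim graph): heredity of those hypotheses for connected tempered coverings
of finite coherent bases (abc-iut-L3-d6, `cor39Hypotheses_coveringGraph_of_finite`) at the connected
tempered object `𝒢_{∞,F}`. [cite: MochizukiSemiAnbd2006, Cor 3.9 p.42] -/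
theorem cor39Hypotheses_univCoverOver [Finite 𝒢.graph.Vertex] [Finite 𝒢.graph.Edge]
    (h39 : Cor39Hypotheses 𝒢) (hcoh : 𝒢.IsCoherent) (hF : F.IsFinite) (V₀ : F.OVertex)
    (h𝒢 : 𝒢.IsCountable) : Cor39Hypotheses (F.univCoverOver (Sum.inl V₀) h𝒢).coveringGraph :=
  (F.univCoverOver (Sum.inl V₀) h𝒢).cor39Hypotheses_coveringGraph_of_finite h39 hcoh
    (F.univCoverOver_isTempered_of_cor39 h39 hF V₀ h𝒢)
    (F.isConnectedObj_univCoverOverT_of_cor39 h39 hF V₀ h𝒢)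

/-- **Thm. 3.7 (iii) AT `𝒢_{∞,F}`** over a finite coherent Cor-3.9 base (abc-iut-w6-d120's
`compactInVerticialAt_univCoverOver`, the Thm-3.7 hypotheses on the base read off the Cor-3.9 ones; any
countability witness). [cite: MochizukiSemiAnbd2006, Thm 3.7(iii) pp.40-41] -/
theorem compactInVerticialAt_univCoverOver_of_cor39 [Finite 𝒢.graph.Vertex] [Finite 𝒢.graph.Edge]
    (h39 : Cor39Hypotheses 𝒢) (hcoh : 𝒢.IsCoherent) (hF : F.IsFinite) (V₀ : F.OVertex)
    (h𝒢 : 𝒢.IsCountable) : CompactInVerticialAt (F.univCoverOver (Sum.inl V₀) h𝒢).coveringGraph :=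
  F.compactInVerticialAt_univCoverOver h39.thm37Hypotheses hcoh hF V₀

/-- Thm. 3.7 (iv) AT `𝒢_{∞,F}` over a finite coherent Cor-3.9 base, `At`-predicate currency.
[cite: MochizukiSemiAnbd2006, Thm 3.7(iv) p.41] -/
theorem maximalCompactIffVerticialAt_univCoverOver_of_cor39 [Finite 𝒢.graph.Vertex]
    [Finite 𝒢.graph.Edge] (h39 : Cor39Hypotheses 𝒢) (hcoh : 𝒢.IsCoherent) (hF : F.IsFinite)
    (V₀ : F.OVertex) (h𝒢 : 𝒢.IsCountable) :
    MaximalCompactIffVerticialAt (F.univCoverOver (Sum.inl V₀) h𝒢).coveringGraph :=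
  F.maximalCompactIffVerticialAt_univCoverOver h39.thm37Hypotheses hcoh hF V₀

/-! ### Corollary 3.9, up to twist, at a pair of universal graph-coverings `(𝒢_{∞,F}, ℋ_{∞,F′})` -/

/-- **[SemiAnbd] Corollary 3.9 AT THE PAIR `(𝒢_{∞,F}, ℋ_{∞,F′})` of universal graph-coverings over
FINITE covering objects `F`, `F′` of FINITE coherent graphs `𝒢`, `ℋ` satisfying the hypotheses of
Cor. 3.9 — up to twist, every pair of charts, with NO residual hypothesis**: (a) a homomorphism
`π₁^temp(𝒢_{∞,F}) → π₁^temp(ℋ_{∞,F′})` induced up to twist by a locally open morphism is compatibly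
quasi-geometric; (b) every compatibly quasi-geometric homomorphism is so induced by a locally open
morphism, with unique vertex and edge maps.  (abc-iut-w4-d080's per-pair closer `cor39UpToTwistAt`,
both Thm. 3.7 (iii) inputs THEOREMS at universal graph-coverings, both Cor-3.9 hypothesis bundles
hereditary.) [cite: MochizukiSemiAnbd2006, Cor 3.9 pp.42-43] -/
theorem cor39UpToTwistAt_univCoverOver [Finite 𝒢.graph.Vertex] [Finite 𝒢.graph.Edge]
    [Finite ℋ.graph.Vertex] [Finite ℋ.graph.Edge] (h𝒢 : Cor39Hypotheses 𝒢) (hcoh : 𝒢.IsCoherent)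
    (hℋ : Cor39Hypotheses ℋ) (hcohℋ : ℋ.IsCoherent) (hF : F.IsFinite) (V₀ : F.OVertex)
    (hF' : F'.IsFinite) (W₀ : F'.OVertex) (hc𝒢 : 𝒢.IsCountable) (hcℋ : ℋ.IsCountable)
    (c : TemperedPiChart (F.univCoverOver (Sum.inl V₀) hc𝒢).coveringGraph)
    (c' : TemperedPiChart (F'.univCoverOver (Sum.inl W₀) hcℋ).coveringGraph) :
    (∀ (Φ : Hom (F.univCoverOver (Sum.inl V₀) hc𝒢).coveringGraph
        (F'.univCoverOver (Sum.inl W₀) hcℋ).coveringGraph), Φ.IsLocallyOpen → ∀ φ : c.G →ₜ* c'.G,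
        (∃ θ : Φ.ConjugatorFamily, Nonempty (Φ.chartPullbackWith θ c c' ≅ BTemp.res φ)) →
          IsCompatiblyQuasiGeometric φ) ∧
      ∀ φ : c.G →ₜ* c'.G, IsCompatiblyQuasiGeometric φ →
        ∃ Φ : Hom (F.univCoverOver (Sum.inl V₀) hc𝒢).coveringGraph
            (F'.univCoverOver (Sum.inl W₀) hcℋ).coveringGraph, Φ.IsLocallyOpen ∧
          (∃ θ : Φ.ConjugatorFamily, Nonempty (Φ.chartPullbackWith θ c c' ≅ BTemp.res φ)) ∧
          ∀ Φ' : Hom (F.univCoverOver (Sum.inl V₀) hc𝒢).coveringGraph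
              (F'.univCoverOver (Sum.inl W₀) hcℋ).coveringGraph, Φ'.IsLocallyOpen →
            (∃ θ' : Φ'.ConjugatorFamily, Nonempty (Φ'.chartPullbackWith θ' c c' ≅ BTemp.res φ)) →
              Φ'.base.vertexMap = Φ.base.vertexMap ∧ Φ'.base.edgeMap = Φ.base.edgeMap :=
  cor39UpToTwistAt (F.compactInVerticialAt_univCoverOver_of_cor39 h𝒢 hcoh hF V₀ hc𝒢)
    (F'.compactInVerticialAt_univCoverOver_of_cor39 hℋ hcohℋ hF' W₀ hcℋ)
    (F.cor39Hypotheses_univCoverOver h𝒢 hcoh hF V₀ hc𝒢)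
    (F'.cor39Hypotheses_univCoverOver hℋ hcohℋ hF' W₀ hcℋ) c c'

/-- **The same with FULL uniqueness of the underlying morphism of semi-graphs** (vertex, edge and branch
maps) at the pair `(𝒢_{∞,F}, ℋ_{∞,F′})`. [cite: MochizukiSemiAnbd2006, Cor 3.9 pp.42-43] -/
theorem cor39UpToTwist_baseAt_univCoverOver [Finite 𝒢.graph.Vertex] [Finite 𝒢.graph.Edge]
    [Finite ℋ.graph.Vertex] [Finite ℋ.graph.Edge] (h𝒢 : Cor39Hypotheses 𝒢) (hcoh : 𝒢.IsCoherent)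
    (hℋ : Cor39Hypotheses ℋ) (hcohℋ : ℋ.IsCoherent) (hF : F.IsFinite) (V₀ : F.OVertex)
    (hF' : F'.IsFinite) (W₀ : F'.OVertex) (hc𝒢 : 𝒢.IsCountable) (hcℋ : ℋ.IsCountable)
    (c : TemperedPiChart (F.univCoverOver (Sum.inl V₀) hc𝒢).coveringGraph)
    (c' : TemperedPiChart (F'.univCoverOver (Sum.inl W₀) hcℋ).coveringGraph) :
    (∀ (Φ : Hom (F.univCoverOver (Sum.inl V₀) hc𝒢).coveringGraph
        (F'.univCoverOver (Sum.inl W₀) hcℋ).coveringGraph), Φ.IsLocallyOpen → ∀ φ : c.G →ₜ* c'.G,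
        (∃ θ : Φ.ConjugatorFamily, Nonempty (Φ.chartPullbackWith θ c c' ≅ BTemp.res φ)) →
          IsCompatiblyQuasiGeometric φ) ∧
      ∀ φ : c.G →ₜ* c'.G, IsCompatiblyQuasiGeometric φ →
        ∃ Φ : Hom (F.univCoverOver (Sum.inl V₀) hc𝒢).coveringGraph
            (F'.univCoverOver (Sum.inl W₀) hcℋ).coveringGraph, Φ.IsLocallyOpen ∧
          (∃ θ : Φ.ConjugatorFamily, Nonempty (Φ.chartPullbackWith θ c c' ≅ BTemp.res φ)) ∧
          ∀ Φ' : Hom (F.univCoverOver (Sum.inl V₀) hc𝒢).coveringGraph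
              (F'.univCoverOver (Sum.inl W₀) hcℋ).coveringGraph, Φ'.IsLocallyOpen →
            (∃ θ' : Φ'.ConjugatorFamily, Nonempty (Φ'.chartPullbackWith θ' c c' ≅ BTemp.res φ)) →
              Φ'.base = Φ.base :=
  cor39UpToTwist_baseAt (F.compactInVerticialAt_univCoverOver_of_cor39 h𝒢 hcoh hF V₀ hc𝒢)
    (F'.compactInVerticialAt_univCoverOver_of_cor39 hℋ hcohℋ hF' W₀ hcℋ)
    (F.cor39Hypotheses_univCoverOver h𝒢 hcoh hF V₀ hc𝒢)
    (F'.cor39Hypotheses_univCoverOver hℋ hcohℋ hF' W₀ hcℋ) c c'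

/-- **[SemiAnbd] Corollary 3.9 at the pair `(𝒢_{∞,F}, ℋ_{∞,F′})`, in the NAMED currency
`InducesUpToTwist`** (the body of abc-iut-w4-d080's `Cor39CompatUpToTwist` at the pair, no residual
hypothesis): (a) `Φ.InducesUpToTwist φ` for a locally open `Φ` ⇒ `φ` compatibly quasi-geometric; (b)
every compatibly quasi-geometric `φ` is `InducesUpToTwist`-induced by a locally open `Φ`, unique as a
morphism of the underlying semi-graphs. [cite: MochizukiSemiAnbd2006, Cor 3.9 pp.42-43] -/
theorem cor39CompatUpToTwistAt_univCoverOver [Finite 𝒢.graph.Vertex] [Finite 𝒢.graph.Edge]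
    [Finite ℋ.graph.Vertex] [Finite ℋ.graph.Edge] (h𝒢 : Cor39Hypotheses 𝒢) (hcoh : 𝒢.IsCoherent)
    (hℋ : Cor39Hypotheses ℋ) (hcohℋ : ℋ.IsCoherent) (hF : F.IsFinite) (V₀ : F.OVertex)
    (hF' : F'.IsFinite) (W₀ : F'.OVertex) (hc𝒢 : 𝒢.IsCountable) (hcℋ : ℋ.IsCountable)
    (c : TemperedPiChart (F.univCoverOver (Sum.inl V₀) hc𝒢).coveringGraph)
    (c' : TemperedPiChart (F'.univCoverOver (Sum.inl W₀) hcℋ).coveringGraph) :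
    (∀ (Φ : Hom (F.univCoverOver (Sum.inl V₀) hc𝒢).coveringGraph
        (F'.univCoverOver (Sum.inl W₀) hcℋ).coveringGraph), Φ.IsLocallyOpen → ∀ φ : c.G →ₜ* c'.G,
        Φ.InducesUpToTwist c c' φ → IsCompatiblyQuasiGeometric φ) ∧
      ∀ φ : c.G →ₜ* c'.G, IsCompatiblyQuasiGeometric φ →
        ∃ Φ : Hom (F.univCoverOver (Sum.inl V₀) hc𝒢).coveringGraph
            (F'.univCoverOver (Sum.inl W₀) hcℋ).coveringGraph,
          Φ.IsLocallyOpen ∧ Φ.InducesUpToTwist c c' φ ∧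
          ∀ Φ' : Hom (F.univCoverOver (Sum.inl V₀) hc𝒢).coveringGraph
              (F'.univCoverOver (Sum.inl W₀) hcℋ).coveringGraph,
            Φ'.IsLocallyOpen → Φ'.InducesUpToTwist c c' φ → Φ'.base = Φ.base :=
  cor39CompatUpToTwistAt (F.compactInVerticialAt_univCoverOver_of_cor39 h𝒢 hcoh hF V₀ hc𝒢)
    (F'.compactInVerticialAt_univCoverOver_of_cor39 hℋ hcohℋ hF' W₀ hcℋ)
    (F.cor39Hypotheses_univCoverOver h𝒢 hcoh hF V₀ hc𝒢)
    (F'.cor39Hypotheses_univCoverOver hℋ hcohℋ hF' W₀ hcℋ) c c'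

/-- **Cor. 3.9 (a) at `(𝒢_{∞,F}, ℋ_{∞,F′})`** (named projection for consumers): a homomorphism
`π₁^temp(𝒢_{∞,F}) → π₁^temp(ℋ_{∞,F′})` induced up to twist by a locally open morphism of the covering
semi-graphs of anabelioids is compatibly quasi-geometric. [cite: MochizukiSemiAnbd2006, Cor 3.9 pp.42-43] -/
theorem isCompatiblyQuasiGeometric_of_inducesUpToTwist_univCoverOver [Finite 𝒢.graph.Vertex]
    [Finite 𝒢.graph.Edge] [Finite ℋ.graph.Vertex] [Finite ℋ.graph.Edge] (h𝒢 : Cor39Hypotheses 𝒢)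
    (hcoh : 𝒢.IsCoherent) (hℋ : Cor39Hypotheses ℋ) (hcohℋ : ℋ.IsCoherent) (hF : F.IsFinite)
    (V₀ : F.OVertex) (hF' : F'.IsFinite) (W₀ : F'.OVertex) (hc𝒢 : 𝒢.IsCountable)
    (hcℋ : ℋ.IsCountable) (c : TemperedPiChart (F.univCoverOver (Sum.inl V₀) hc𝒢).coveringGraph)
    (c' : TemperedPiChart (F'.univCoverOver (Sum.inl W₀) hcℋ).coveringGraph)
    (Φ : Hom (F.univCoverOver (Sum.inl V₀) hc𝒢).coveringGraph
      (F'.univCoverOver (Sum.inl W₀) hcℋ).coveringGraph) (hΦ : Φ.IsLocallyOpen)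
    (φ : c.G →ₜ* c'.G) (hind : Φ.InducesUpToTwist c c' φ) : IsCompatiblyQuasiGeometric φ :=
  (F.cor39CompatUpToTwistAt_univCoverOver F' h𝒢 hcoh hℋ hcohℋ hF V₀ hF' W₀ hc𝒢 hcℋ c c').1 Φ hΦ φ hind

/-- **Cor. 3.9 (b), existence with uniqueness of the underlying morphism, at `(𝒢_{∞,F}, ℋ_{∞,F′})`**
(named projection for consumers): every compatibly quasi-geometric `φ : π₁^temp(𝒢_{∞,F}) →
π₁^temp(ℋ_{∞,F′})` is induced up to twist by a locally open morphism of the covering semi-graphs of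
anabelioids, whose underlying morphism of semi-graphs is unique.
[cite: MochizukiSemiAnbd2006, Cor 3.9 pp.42-43] -/
theorem exists_hom_inducesUpToTwist_univCoverOver [Finite 𝒢.graph.Vertex] [Finite 𝒢.graph.Edge]
    [Finite ℋ.graph.Vertex] [Finite ℋ.graph.Edge] (h𝒢 : Cor39Hypotheses 𝒢) (hcoh : 𝒢.IsCoherent)
    (hℋ : Cor39Hypotheses ℋ) (hcohℋ : ℋ.IsCoherent) (hF : F.IsFinite) (V₀ : F.OVertex)
    (hF' : F'.IsFinite) (W₀ : F'.OVertex) (hc𝒢 : 𝒢.IsCountable) (hcℋ : ℋ.IsCountable)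
    (c : TemperedPiChart (F.univCoverOver (Sum.inl V₀) hc𝒢).coveringGraph)
    (c' : TemperedPiChart (F'.univCoverOver (Sum.inl W₀) hcℋ).coveringGraph) (φ : c.G →ₜ* c'.G)
    (hφ : IsCompatiblyQuasiGeometric φ) :
    ∃ Φ : Hom (F.univCoverOver (Sum.inl V₀) hc𝒢).coveringGraph
        (F'.univCoverOver (Sum.inl W₀) hcℋ).coveringGraph,
      Φ.IsLocallyOpen ∧ Φ.InducesUpToTwist c c' φ ∧
      ∀ Φ' : Hom (F.univCoverOver (Sum.inl V₀) hc𝒢).coveringGraph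
          (F'.univCoverOver (Sum.inl W₀) hcℋ).coveringGraph,
        Φ'.IsLocallyOpen → Φ'.InducesUpToTwist c c' φ → Φ'.base = Φ.base :=
  (F.cor39CompatUpToTwistAt_univCoverOver F' h𝒢 hcoh hℋ hcohℋ hF V₀ hF' W₀ hc𝒢 hcℋ c c').2 φ hφ

/-! ### Mixed pairs: `𝒢_{∞,F}` against an arbitrary connected tempered covering, or a finite graph -/

/-- **Cor. 3.9, up to twist, at the pair `(𝒢_{∞,F}, ℋ_T)`** for `F` finite over a finite coherent
Cor-3.9 `𝒢` and `T` ANY connected tempered covering object of a finite coherent Cor-3.9 `ℋ` (e.g. a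
finite covering, or another universal graph-covering): abc-iut-L3-d6's
`cor39UpToTwistAt_coveringGraph_of_finite'` at `S := 𝒢_{∞,F}`. [cite: MochizukiSemiAnbd2006, Cor 3.9 pp.42-43] -/
theorem cor39UpToTwistAt_univCoverOver_coveringGraph [Finite 𝒢.graph.Vertex] [Finite 𝒢.graph.Edge]
    [Finite ℋ.graph.Vertex] [Finite ℋ.graph.Edge] (h𝒢 : Cor39Hypotheses 𝒢) (hcoh : 𝒢.IsCoherent)
    (hℋ : Cor39Hypotheses ℋ) (hcohℋ : ℋ.IsCoherent) (hF : F.IsFinite) (V₀ : F.OVertex)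
    (hc𝒢 : 𝒢.IsCountable) (T : CovObj ℋ) (hT : T.IsTempered)
    (hTc : IsConnectedObj (⟨T, hT⟩ : BTempCat ℋ))
    (c : TemperedPiChart (F.univCoverOver (Sum.inl V₀) hc𝒢).coveringGraph)
    (cT : TemperedPiChart T.coveringGraph) :
    (∀ (Φ : Hom (F.univCoverOver (Sum.inl V₀) hc𝒢).coveringGraph T.coveringGraph), Φ.IsLocallyOpen →
        ∀ φ : c.G →ₜ* cT.G,
          (∃ θ : Φ.ConjugatorFamily, Nonempty (Φ.chartPullbackWith θ c cT ≅ BTemp.res φ)) →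
            IsCompatiblyQuasiGeometric φ) ∧
      ∀ φ : c.G →ₜ* cT.G, IsCompatiblyQuasiGeometric φ →
        ∃ Φ : Hom (F.univCoverOver (Sum.inl V₀) hc𝒢).coveringGraph T.coveringGraph, Φ.IsLocallyOpen ∧
          (∃ θ : Φ.ConjugatorFamily, Nonempty (Φ.chartPullbackWith θ c cT ≅ BTemp.res φ)) ∧
          ∀ Φ' : Hom (F.univCoverOver (Sum.inl V₀) hc𝒢).coveringGraph T.coveringGraph,
            Φ'.IsLocallyOpen →
            (∃ θ' : Φ'.ConjugatorFamily, Nonempty (Φ'.chartPullbackWith θ' c cT ≅ BTemp.res φ)) →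
              Φ'.base.vertexMap = Φ.base.vertexMap ∧ Φ'.base.edgeMap = Φ.base.edgeMap :=
  (F.univCoverOver (Sum.inl V₀) hc𝒢).cor39UpToTwistAt_coveringGraph_of_finite' h𝒢 hcoh hℋ hcohℋ
    (F.univCoverOver_isTempered_of_cor39 h𝒢 hF V₀ hc𝒢)
    (F.isConnectedObj_univCoverOverT_of_cor39 h𝒢 hF V₀ hc𝒢) T hT hTc c cT

/-- **Cor. 3.9, up to twist, at the pair `(𝒢_{∞,F}, ℋ)`** with `ℋ` a FINITE graph satisfying the
hypotheses of Cor. 3.9 (the shape of the covering map `𝒢_∞ → 𝒢` itself, [EtTh]'s `Y → X`): Thm. 3.7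
(iii) at `𝒢_{∞,F}` by the above, at `ℋ` by abc-iut-L3-t8's `compactInVerticialAt_of_finiteGraph`.
[cite: MochizukiSemiAnbd2006, Cor 3.9 pp.42-43] -/
theorem cor39UpToTwistAt_univCoverOver_of_finite [Finite 𝒢.graph.Vertex] [Finite 𝒢.graph.Edge]
    [Finite ℋ.graph.Vertex] [Finite ℋ.graph.Edge] (h𝒢 : Cor39Hypotheses 𝒢) (hcoh : 𝒢.IsCoherent)
    (hℋ : Cor39Hypotheses ℋ) (hF : F.IsFinite) (V₀ : F.OVertex) (hc𝒢 : 𝒢.IsCountable)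
    (c : TemperedPiChart (F.univCoverOver (Sum.inl V₀) hc𝒢).coveringGraph) (cℋ : TemperedPiChart ℋ) :
    (∀ (Φ : Hom (F.univCoverOver (Sum.inl V₀) hc𝒢).coveringGraph ℋ), Φ.IsLocallyOpen →
        ∀ φ : c.G →ₜ* cℋ.G,
          (∃ θ : Φ.ConjugatorFamily, Nonempty (Φ.chartPullbackWith θ c cℋ ≅ BTemp.res φ)) →
            IsCompatiblyQuasiGeometric φ) ∧
      ∀ φ : c.G →ₜ* cℋ.G, IsCompatiblyQuasiGeometric φ →
        ∃ Φ : Hom (F.univCoverOver (Sum.inl V₀) hc𝒢).coveringGraph ℋ, Φ.IsLocallyOpen ∧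
          (∃ θ : Φ.ConjugatorFamily, Nonempty (Φ.chartPullbackWith θ c cℋ ≅ BTemp.res φ)) ∧
          ∀ Φ' : Hom (F.univCoverOver (Sum.inl V₀) hc𝒢).coveringGraph ℋ, Φ'.IsLocallyOpen →
            (∃ θ' : Φ'.ConjugatorFamily, Nonempty (Φ'.chartPullbackWith θ' c cℋ ≅ BTemp.res φ)) →
              Φ'.base.vertexMap = Φ.base.vertexMap ∧ Φ'.base.edgeMap = Φ.base.edgeMap :=
  cor39UpToTwistAt (F.compactInVerticialAt_univCoverOver_of_cor39 h𝒢 hcoh hF V₀ hc𝒢)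
    compactInVerticialAt_of_finiteGraph (F.cor39Hypotheses_univCoverOver h𝒢 hcoh hF V₀ hc𝒢) hℋ c cℋ

end CovObj

/-! ### The one-sheeted case: the universal graph-coverings `𝒢_∞`, `ℋ_∞` of `𝔾`, `ℍ` themselves -/

/-- **The hypotheses of Cor. 3.9 hold at the universal graph-covering `𝒢_∞` of a finite coherent Cor-3.9
graph** (`𝒢_∞ := 𝒢_{∞,F}` for the one-sheeted `F := trivialCov 𝒢 PUnit`, based at any vertex-orbit
`V₀`; for the dual graph of the Tate curve this is the bi-infinite chain `Y` of [EtTh] §1).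
[cite: MochizukiSemiAnbd2006, Cor 3.9 p.42] -/
theorem cor39Hypotheses_univCover [Finite 𝒢.graph.Vertex] [Finite 𝒢.graph.Edge]
    (h39 : Cor39Hypotheses 𝒢) (hcoh : 𝒢.IsCoherent)
    (V₀ : (CovObj.trivialCov 𝒢 PUnit.{u + 1}).OVertex) (h𝒢 : 𝒢.IsCountable) :
    Cor39Hypotheses ((CovObj.trivialCov 𝒢 PUnit.{u + 1}).univCoverOver (Sum.inl V₀) h𝒢).coveringGraph :=
  (CovObj.trivialCov 𝒢 PUnit.{u + 1}).cor39Hypotheses_univCoverOver h39 hcoh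
    (CovObj.trivialCov_punit_isFinite 𝒢) V₀ h𝒢

/-- **[SemiAnbd] Corollary 3.9, up to twist, AT THE PAIR `(𝒢_∞, ℋ_∞)` of universal graph-coverings of
two finite coherent Cor-3.9 graphs** (the [EtTh] §1 shape `Y ↔ Y′` for two punctured Tate curves), every
pair of charts, no residual hypothesis. [cite: MochizukiSemiAnbd2006, Cor 3.9 pp.42-43] -/
theorem cor39UpToTwistAt_univCover [Finite 𝒢.graph.Vertex] [Finite 𝒢.graph.Edge]
    [Finite ℋ.graph.Vertex] [Finite ℋ.graph.Edge] (h𝒢 : Cor39Hypotheses 𝒢) (hcoh : 𝒢.IsCoherent)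
    (hℋ : Cor39Hypotheses ℋ) (hcohℋ : ℋ.IsCoherent)
    (V₀ : (CovObj.trivialCov 𝒢 PUnit.{u + 1}).OVertex)
    (W₀ : (CovObj.trivialCov ℋ PUnit.{u + 1}).OVertex) (hc𝒢 : 𝒢.IsCountable) (hcℋ : ℋ.IsCountable)
    (c : TemperedPiChart
      ((CovObj.trivialCov 𝒢 PUnit.{u + 1}).univCoverOver (Sum.inl V₀) hc𝒢).coveringGraph)
    (c' : TemperedPiChart
      ((CovObj.trivialCov ℋ PUnit.{u + 1}).univCoverOver (Sum.inl W₀) hcℋ).coveringGraph) :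
    (∀ (Φ : Hom ((CovObj.trivialCov 𝒢 PUnit.{u + 1}).univCoverOver (Sum.inl V₀) hc𝒢).coveringGraph
        ((CovObj.trivialCov ℋ PUnit.{u + 1}).univCoverOver (Sum.inl W₀) hcℋ).coveringGraph),
        Φ.IsLocallyOpen → ∀ φ : c.G →ₜ* c'.G,
          (∃ θ : Φ.ConjugatorFamily, Nonempty (Φ.chartPullbackWith θ c c' ≅ BTemp.res φ)) →
            IsCompatiblyQuasiGeometric φ) ∧
      ∀ φ : c.G →ₜ* c'.G, IsCompatiblyQuasiGeometric φ →
        ∃ Φ : Hom ((CovObj.trivialCov 𝒢 PUnit.{u + 1}).univCoverOver (Sum.inl V₀) hc𝒢).coveringGraph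
            ((CovObj.trivialCov ℋ PUnit.{u + 1}).univCoverOver (Sum.inl W₀) hcℋ).coveringGraph,
          Φ.IsLocallyOpen ∧
          (∃ θ : Φ.ConjugatorFamily, Nonempty (Φ.chartPullbackWith θ c c' ≅ BTemp.res φ)) ∧
          ∀ Φ' : Hom
              ((CovObj.trivialCov 𝒢 PUnit.{u + 1}).univCoverOver (Sum.inl V₀) hc𝒢).coveringGraph
              ((CovObj.trivialCov ℋ PUnit.{u + 1}).univCoverOver (Sum.inl W₀) hcℋ).coveringGraph,
            Φ'.IsLocallyOpen →
            (∃ θ' : Φ'.ConjugatorFamily, Nonempty (Φ'.chartPullbackWith θ' c c' ≅ BTemp.res φ)) →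
              Φ'.base.vertexMap = Φ.base.vertexMap ∧ Φ'.base.edgeMap = Φ.base.edgeMap :=
  (CovObj.trivialCov 𝒢 PUnit.{u + 1}).cor39UpToTwistAt_univCoverOver
    (CovObj.trivialCov ℋ PUnit.{u + 1}) h𝒢 hcoh hℋ hcohℋ (CovObj.trivialCov_punit_isFinite 𝒢) V₀
    (CovObj.trivialCov_punit_isFinite ℋ) W₀ hc𝒢 hcℋ c c'

/-- **[SemiAnbd] Corollary 3.9 at the pair `(𝒢_∞, ℋ_∞)`, named `InducesUpToTwist` currency** (the
body of `Cor39CompatUpToTwist` at the pair, no residual hypothesis).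
[cite: MochizukiSemiAnbd2006, Cor 3.9 pp.42-43] -/
theorem cor39CompatUpToTwistAt_univCover [Finite 𝒢.graph.Vertex] [Finite 𝒢.graph.Edge]
    [Finite ℋ.graph.Vertex] [Finite ℋ.graph.Edge] (h𝒢 : Cor39Hypotheses 𝒢) (hcoh : 𝒢.IsCoherent)
    (hℋ : Cor39Hypotheses ℋ) (hcohℋ : ℋ.IsCoherent)
    (V₀ : (CovObj.trivialCov 𝒢 PUnit.{u + 1}).OVertex)
    (W₀ : (CovObj.trivialCov ℋ PUnit.{u + 1}).OVertex) (hc𝒢 : 𝒢.IsCountable) (hcℋ : ℋ.IsCountable)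
    (c : TemperedPiChart
      ((CovObj.trivialCov 𝒢 PUnit.{u + 1}).univCoverOver (Sum.inl V₀) hc𝒢).coveringGraph)
    (c' : TemperedPiChart
      ((CovObj.trivialCov ℋ PUnit.{u + 1}).univCoverOver (Sum.inl W₀) hcℋ).coveringGraph) :
    (∀ (Φ : Hom ((CovObj.trivialCov 𝒢 PUnit.{u + 1}).univCoverOver (Sum.inl V₀) hc𝒢).coveringGraph
        ((CovObj.trivialCov ℋ PUnit.{u + 1}).univCoverOver (Sum.inl W₀) hcℋ).coveringGraph),
        Φ.IsLocallyOpen → ∀ φ : c.G →ₜ* c'.G, Φ.InducesUpToTwist c c' φ →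
          IsCompatiblyQuasiGeometric φ) ∧
      ∀ φ : c.G →ₜ* c'.G, IsCompatiblyQuasiGeometric φ →
        ∃ Φ : Hom ((CovObj.trivialCov 𝒢 PUnit.{u + 1}).univCoverOver (Sum.inl V₀) hc𝒢).coveringGraph
            ((CovObj.trivialCov ℋ PUnit.{u + 1}).univCoverOver (Sum.inl W₀) hcℋ).coveringGraph,
          Φ.IsLocallyOpen ∧ Φ.InducesUpToTwist c c' φ ∧
          ∀ Φ' : Hom
              ((CovObj.trivialCov 𝒢 PUnit.{u + 1}).univCoverOver (Sum.inl V₀) hc𝒢).coveringGraph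
              ((CovObj.trivialCov ℋ PUnit.{u + 1}).univCoverOver (Sum.inl W₀) hcℋ).coveringGraph,
            Φ'.IsLocallyOpen → Φ'.InducesUpToTwist c c' φ → Φ'.base = Φ.base :=
  (CovObj.trivialCov 𝒢 PUnit.{u + 1}).cor39CompatUpToTwistAt_univCoverOver
    (CovObj.trivialCov ℋ PUnit.{u + 1}) h𝒢 hcoh hℋ hcohℋ (CovObj.trivialCov_punit_isFinite 𝒢) V₀
    (CovObj.trivialCov_punit_isFinite ℋ) W₀ hc𝒢 hcℋ c c'

/-- **Cor. 3.9, up to twist, at the pair `(𝒢_∞, 𝒢)`** — the universal graph-covering against its own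
finite coherent Cor-3.9 base (the [EtTh] §1 shape `Y → X`), every pair of charts, no residual hypothesis.
[cite: MochizukiSemiAnbd2006, Cor 3.9 pp.42-43] -/
theorem cor39UpToTwistAt_univCover_base [Finite 𝒢.graph.Vertex] [Finite 𝒢.graph.Edge]
    (h𝒢 : Cor39Hypotheses 𝒢) (hcoh : 𝒢.IsCoherent)
    (V₀ : (CovObj.trivialCov 𝒢 PUnit.{u + 1}).OVertex) (hc𝒢 : 𝒢.IsCountable)
    (c : TemperedPiChart
      ((CovObj.trivialCov 𝒢 PUnit.{u + 1}).univCoverOver (Sum.inl V₀) hc𝒢).coveringGraph)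
    (c𝒢 : TemperedPiChart 𝒢) :
    (∀ (Φ : Hom ((CovObj.trivialCov 𝒢 PUnit.{u + 1}).univCoverOver (Sum.inl V₀) hc𝒢).coveringGraph 𝒢),
        Φ.IsLocallyOpen → ∀ φ : c.G →ₜ* c𝒢.G,
          (∃ θ : Φ.ConjugatorFamily, Nonempty (Φ.chartPullbackWith θ c c𝒢 ≅ BTemp.res φ)) →
            IsCompatiblyQuasiGeometric φ) ∧
      ∀ φ : c.G →ₜ* c𝒢.G, IsCompatiblyQuasiGeometric φ →
        ∃ Φ : Hom ((CovObj.trivialCov 𝒢 PUnit.{u + 1}).univCoverOver (Sum.inl V₀) hc𝒢).coveringGraph 𝒢,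
          Φ.IsLocallyOpen ∧
          (∃ θ : Φ.ConjugatorFamily, Nonempty (Φ.chartPullbackWith θ c c𝒢 ≅ BTemp.res φ)) ∧
          ∀ Φ' : Hom
              ((CovObj.trivialCov 𝒢 PUnit.{u + 1}).univCoverOver (Sum.inl V₀) hc𝒢).coveringGraph 𝒢,
            Φ'.IsLocallyOpen →
            (∃ θ' : Φ'.ConjugatorFamily, Nonempty (Φ'.chartPullbackWith θ' c c𝒢 ≅ BTemp.res φ)) →
              Φ'.base.vertexMap = Φ.base.vertexMap ∧ Φ'.base.edgeMap = Φ.base.edgeMap :=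
  (CovObj.trivialCov 𝒢 PUnit.{u + 1}).cor39UpToTwistAt_univCoverOver_of_finite h𝒢 hcoh h𝒢
    (CovObj.trivialCov_punit_isFinite 𝒢) V₀ hc𝒢 c c𝒢

end ProfiniteSemiGraph

end Literature.AnabelianGeometry.SemiGraphs
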